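import Summits.SmoothPoincare4.SmoothPoincare4.Theses.ZeroSurgeryExotic

/-!
# SmoothPoincare4 / ZeroSurgeryExotic — assembly v2 (b)

Settles item stmt-SmoothPoincare4-0522 (`Assembly4` of route ZeroSurgeryExotic): granted the
Manolescu–Piccirillo trace-embedding step in `IsIntegralSurgery` form (if `Y` is `0`-surgery on both
`K` and `K'` and `K` is smoothly slice, then `K'` is slice in a homotopy 4-ball), the route thesis
`ZseThesis` (a `0`-surgery pair with `K` slice and `K'` not slice) yields the waypoint
`ZseHsliceNotSlice` (a knot slice in a homotopy 4-ball but not in `B⁴`).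

Pure logic: destructure the thesis and apply the hypothesis to `(K, K', Y)`; the witness is `K'`.
Nothing else is used (no named facts). [Manolescu–Piccirillo 2023, §1 and Lemma 3.3;
Freedman–Gompf–Morrison–Walker 2010, §1]

DEPENDENCY DRIFT (2026-08-17). The LINT AUTOFIX of 2026-08-16T14:15:59Z dropped the duplicate assembly
items `Assembly2/3/4` from the generated route file `Theses.ZeroSurgeryExotic` (kept: the `Assembly` that
`closes` uses); stmt-SmoothPoincare4-0522 stays CLOSED (proved by `Assembly4_proof` @ 3ffeb756c9fb) but its
decl `Assembly4` is no longer rendered, so this record stopped elaborating. It is kept compiling, with the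
theorem's statement text unchanged, by re-declaring `Assembly4` below in the route's namespace with the
item's registered signature VERBATIM (nothing imports this module; no other file names the decl).
-/

/-! ### The retired route decl, re-declared (lint autofix of 2026-08-16 dropped it) -/

namespace Summit.SmoothPoincare4.SmoothPoincare4.Theses.ZeroSurgeryExotic

open scoped Manifold in
/-- RETIRED route decl `Assembly4` (assembly item stmt-SmoothPoincare4-0522 `zse_assembly_v2b` of route
ZeroSurgeryExotic; CLOSED, proved by `Theorems.Assembly4_proof`; dropped from the generated route file by the
lint autofix of 2026-08-16T14:15:59Z as a duplicate assembly, its text surviving there as a comment):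
(Manolescu–Piccirillo trace-embedding step in `IsIntegralSurgery` form: if `Y` is `0`-surgery on both `K`
and `K'` and `K` is smoothly slice then `K'` is slice in a homotopy `4`-ball) → (the route thesis: a
`0`-surgery pair with `K` slice and `K'` not slice) → (a knot slice in a homotopy `4`-ball but not in
`B⁴`). Re-declared here, in the route's namespace and with the item's registered signature verbatim, solely
so that the record `Assembly4_proof` below keeps elaborating with its statement unchanged; a route-item
definition (pure logic over the route's own notions), not a cited Literature fact, and not asserted. -/
def Assembly4 : Prop :=
  (∀ (K K' : Literature.Topology.FourManifolds.Knot) (Y : Type) [TopologicalSpace Y] [ChartedSpace (EuclideanSpace ℝ (Fin 3)) Y], Literature.Topology.FourManifolds.IsIntegralSurgery (𝓡 3) Y K 0 → Literature.Topology.FourManifolds.IsIntegralSurgery (𝓡 3) Y K' 0 → K.IsSmoothlySlice → K'.IsHomotopyBallSlice) → (∃ (K K' : Literature.Topology.FourManifolds.Knot) (Y : Type) (_ : TopologicalSpace Y) (_ : ChartedSpace (EuclideanSpace ℝ (Fin 3)) Y), Literature.Topology.FourManifolds.IsIntegralSurgery (𝓡 3) Y K 0 ∧ Literature.Topology.FourManifolds.IsIntegralSurgery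 (𝓡 3) Y K' 0 ∧ K.IsSmoothlySlice ∧ ¬ K'.IsSmoothlySlice) → ∃ K : Literature.Topology.FourManifolds.Knot, K.IsHomotopyBallSlice ∧ ¬ K.IsSmoothlySlice

end Summit.SmoothPoincare4.SmoothPoincare4.Theses.ZeroSurgeryExotic

namespace Summit.SmoothPoincare4.SmoothPoincare4.Theorems

open Summit.SmoothPoincare4.SmoothPoincare4.Theses.ZeroSurgeryExotic

/-- Settles stmt-SmoothPoincare4-0522: the assembly `Assembly4` of route ZeroSurgeryExotic —
(MP Lemma 3.3 in `IsIntegralSurgery` form) → `ZseThesis` → `ZseHsliceNotSlice`.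
Proof: unfold, destructure the `0`-surgery pair `(K, K', Y)`, and take `K'` as the witness; its
homotopy-ball sliceness is the hypothesis applied to the pair, its non-sliceness is given. [folklore] -/
theorem Assembly4_proof : Summit.SmoothPoincare4.SmoothPoincare4.Theses.ZeroSurgeryExotic.Assembly4 := by
  unfold Assembly4
  intro hMP h
  obtain ⟨K, K', Y, iT, iC, h1, h2, h3, h4⟩ := h
  exact ⟨K', @hMP K K' Y iT iC h1 h2 h3, h4⟩

end Summit.SmoothPoincare4.SmoothPoincare4.Theorems
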